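import Summits.ResolutionOfSingularities.ResolutionOfSingularities.Theorems.WeightedInvariantLocalWeightedDropWildPurePowerFlagDropZeroShape
import Summits.ResolutionOfSingularities.ResolutionOfSingularities.Theorems.WeightedInvariantLocalWeightedDropWildPurePowerFlagAttain

/-!
# `LocalWeightedDrop`, piece S3πM: [HP24, Prop. 4] case (i) at `t = 0` in the shape of `DropZeroStatement`, COMPANION BRANCH `0 < d_res < q`

Crux item stmt-ResolutionOfSingularities-8899 `LocalWeightedDrop`, class stub S3πM; sub-target `PurePowerFlag.DropZeroStatement` of
res-L1-w43-stub-1's split (STATUS 06:59:31Z).  [OURS · L1 W4.3, chain w43, seat res-D-pv-058 acting as res-L1-w43-stub-6; printed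
mathematics: Hauser–Perlega, PRIMS 60 (2024) Prop. 4 proof case (i) "companion" paragraph, p. 795 l. 6–20 ("If `0 < d_res < pᵉ` … the
companion ideal … `s_𝓖 + ((pᵉ − d)d)! ≤ s_𝓕`"); not a statement of any manuscript.]

* `coeffIdealOrder_eq_inf_mk`: the coefficient-ideal order as a `Finset.inf` of row orders;
* **`sFlag_stepZero_add_cfactorial`**: `sFlag q T E′ g + c! = sFlag q B E (X·g)`, `c = (q − d)d`, along the axis successor with
  `0 < d′_res = d_res < q`, for every `n = 0` child flag `g` (any `E`; `g = 0` when `y` is exceptional) — the game-side reading of the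
  series identity `companion_min_add_factorial_of_step_xy`;
* **`sFlag_ne_top_of_lt`**: in the companion branch `s_𝓕 < ⊤` for every `n = 0` flag (row `0` of `M^d`, resp. of `G^{q−d}`), no
  non-terminality needed;
* **`exists_flag_gt_of_isN0_stepZero_lt`**: DropZeroStatement, first orientation, `n = 0` child flags, branch `0 < d_res(B) < q` — witness
  `f = X·g`;
* `cfactorial_le_coeffIdealOrder_residual_pow`: the `G`-part of `s` along the zero shift is `≥ c!`.
The second orientation and the all-`d_res` corollaries are in the sequel file `…DropZeroCompanionSwap.lean`.
-/

set_option linter.dupNamespace false -- mandated namespace of this single-conjunct summit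

namespace Summit.ResolutionOfSingularities.ResolutionOfSingularities.Theorems

open Literature.AlgebraicGeometry.Resolution
open Literature.AlgebraicGeometry.Resolution.HauserPerlega2024

namespace PurePowerFlag

open MvPowerSeries

variable {k : Type} [Field k]

/-- the exponent `x^a y^b` at `0`. -/
private theorem c_l (a b : ℕ) : (Finsupp.single (0 : Fin 2) a + Finsupp.single (1 : Fin 2) b : Fin 2 →₀ ℕ) 0 = a := by
  rw [Finsupp.add_apply, Finsupp.single_eq_same, Finsupp.single_eq_of_ne (by decide), add_zero]

/-- the exponent `x^a y^b` at `1`. -/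
private theorem c_r (a b : ℕ) : (Finsupp.single (0 : Fin 2) a + Finsupp.single (1 : Fin 2) b : Fin 2 →₀ ℕ) 1 = b := by
  rw [Finsupp.add_apply, Finsupp.single_eq_of_ne (by decide), Finsupp.single_eq_same, zero_add]

/-- every exponent is `x^{m 0} y^{m 1}`. -/
private theorem c_ssa (m : Fin 2 →₀ ℕ) : m = Finsupp.single 0 (m 0) + Finsupp.single 1 (m 1) := by
  ext l
  rcases fin_two_cases l with rfl | rfl
  · rw [c_l]
  · rw [c_r]

/-- degree in two letters. -/
private theorem c_deg (m : Fin 2 →₀ ℕ) : m.degree = m 0 + m 1 := by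
  rw [Finsupp.degree_eq_sum, Fin.sum_univ_two]

/-- `r_x + r_y + d_res ≤ deg m` on the support. -/
private theorem c_exc_add_dRes_le {B : MvPowerSeries (Fin 2) k} (hB : B ≠ 0) (E : Finset (Fin 2)) {m : Fin 2 →₀ ℕ}
    (hm : coeff m B ≠ 0) : excExp B E 0 + excExp B E 1 + dRes B E ≤ m 0 + m 1 := by
  rw [← order_toNat_eq_excExp_add_dRes hB E]
  have h1 := MvPowerSeries.order_le hm
  rw [← (MvPowerSeries.ne_zero_iff_order_finite).mp hB, c_deg] at h1
  exact_mod_cast h1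

/-- The coefficient-ideal order as the `Finset.inf` of the series-level files (rows as `PowerSeries.mk`). -/
theorem coeffIdealOrder_eq_inf_mk (c : ℕ) (H : MvPowerSeries (Fin 2) k) :
    coeffIdealOrder c (0 : Fin 2) 1 H = (Finset.range c).inf fun i => (((c.factorial / (c - i) : ℕ) : ℕ∞) *
      (PowerSeries.mk fun v => coeff (Finsupp.single 0 v + Finsupp.single 1 i) H).order) := by
  unfold coeffIdealOrder
  rw [← Finset.inf_eq_iInf]
  exact Finset.inf_congr rfl fun i _ => by rw [rowOrder_eq_order_mk]

/-- Support of the cleaned expansion along a genuine shift: below every surviving exponent `m` there is a support exponent `d` of `B`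
with `d_x ≤ m_x`, `m_y ≤ d_y`, `deg d ≤ deg m`. -/
theorem exists_of_coeff_expansion_ne_zero (q : ℕ) (B : MvPowerSeries (Fin 2) k) (h : PowerSeries k)
    (hh : PowerSeries.constantCoeff h = 0) {m : Fin 2 →₀ ℕ} (hm : coeff m (expansion q B h) ≠ 0) :
    ∃ d : Fin 2 →₀ ℕ, coeff d B ≠ 0 ∧ d 0 ≤ m 0 ∧ m 1 ≤ d 1 ∧ d 0 + d 1 ≤ m 0 + m 1 := by
  unfold expansion at hm
  have h1 := (coeff_cleanSeries_of_ne_zero q _ m hm).1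
  rw [h1, shift_eq] at hm
  exact exists_coeff_ne_zero_of_coeff_subst_shift 0 1 zero_ne_one_fin fin_two_cases h hh B m hm

/-- the exceptional monomial of `(B, E)` divides the expansion along every `n = 0` flag, and degrees do not drop. -/
theorem excExp_le_of_coeff_expansion_ne_zero (q : ℕ) {B : MvPowerSeries (Fin 2) k} (hB : cleanSeries q B = B) (hB0 : B ≠ 0)
    (E : Finset (Fin 2)) (h : PowerSeries k) (hh : PowerSeries.constantCoeff h = 0) (hN : IsN0 E h) {m : Fin 2 →₀ ℕ}
    (hm : coeff m (expansion q B h) ≠ 0) :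
    excExp B E ≤ m ∧ excExp B E 0 + excExp B E 1 + dRes B E ≤ m 0 + m 1 := by
  obtain ⟨dd, hdd, hx0, -, hdeg⟩ := exists_of_coeff_expansion_ne_zero q B h hh hm
  have hle := excExp_le_of_coeff_ne_zero B E hdd
  refine ⟨fun l => ?_, le_trans (c_exc_add_dRes_le hB0 E hdd) hdeg⟩
  rcases fin_two_cases l with rfl | rfl
  · exact le_trans (hle 0) hx0
  · rcases hN with hy | h0
    · rw [excExp_apply, if_neg hy]; exact Nat.zero_le _
    · subst h0
      rw [expansion_zero, hB] at hm
      exact excExp_le_of_coeff_ne_zero B E hm 1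

/-- **[HP24, Prop. 4 (i)], companion branch: `sFlag q T E′ g + ((q − d)d)! = sFlag q B E (X·g)`** along the axis successor
`X 0 ^ q · T = B(x, xy)` with `0 < d′_res = d_res = d < q`, for every `n = 0` flag `g` of `(T, E′)` (`E′ ∋ x`; `y ∈ E′ ↔ y ∈ E`).
("`M′^d = x^{-dpᵉ+d²}M^d`, `G′^{pᵉ−d} = x^{-(pᵉ−d)d}G^{pᵉ−d}` … `s_𝓖 + ((pᵉ − d)d)! = s`" [HP24 Prop. 4 (i) p. 795 l. 6–20].) -/
theorem sFlag_stepZero_add_cfactorial (q : ℕ) {B T : MvPowerSeries (Fin 2) k} (hB : cleanSeries q B = B) (hB0 : B ≠ 0)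
    (hqo : ((q : ℕ) : ℕ∞) ≤ B.order) (hT : (X 0 : MvPowerSeries (Fin 2) k) ^ q * T = subst (PlaneGerm.dirChart (0 : k)) B)
    {E E' : Finset (Fin 2)} (h0 : (0 : Fin 2) ∈ E') (h1 : (1 : Fin 2) ∈ E' ↔ (1 : Fin 2) ∈ E)
    (hd0 : 0 < dRes B E) (hdq : dRes B E < q) (hd : dRes T E' = dRes B E)
    (g : PowerSeries k) (hg : PowerSeries.constantCoeff g = 0) (hN : IsN0 E' g) :
    sFlag q T E' g + ((((q - dRes B E) * dRes B E).factorial : ℕ) : ℕ∞) = sFlag q B E (PowerSeries.X * g) := by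
  classical
  have hT0 := ne_zero_stepZero q hB0 hT
  have hTc := cleanSeries_of_stepZero q hB hT
  obtain ⟨hrx, hry⟩ := excExp_stepZero q hB0 hqo hT h0 h1
  have hXg : PowerSeries.constantCoeff (PowerSeries.X * g) = 0 := by rw [map_mul, PowerSeries.constantCoeff_X, zero_mul]
  have hNB : IsN0 E (PowerSeries.X * g) := by
    rcases hN with hy | hg0
    · exact Or.inl (fun hm => hy (h1.mpr hm))
    · exact Or.inr (by rw [hg0, mul_zero])
  set d := dRes B E with hdd
  set rx := excExp B E 0 with hrxd
  set ry := excExp B E 1 with hryd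
  set rx' := excExp T E' 0 with hrx'd
  have heB : excExp B E = Finsupp.single 0 rx + Finsupp.single 1 ry := c_ssa _
  have heT : excExp T E' = Finsupp.single 0 rx' + Finsupp.single 1 ry := by rw [c_ssa (excExp T E'), hry]
  have hn : ∀ m, coeff m (expansion q B (PowerSeries.X * g)) ≠ 0 → Finsupp.single 0 rx + Finsupp.single 1 ry ≤ m :=
    fun m hm => by rw [← heB]; exact (excExp_le_of_coeff_expansion_ne_zero q hB hB0 E _ hXg hNB hm).1
  have hn' : ∀ m, coeff m (expansion q T g) ≠ 0 → Finsupp.single 0 rx' + Finsupp.single 1 ry ≤ m :=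
    fun m hm => by rw [← heT]; exact (excExp_le_of_coeff_expansion_ne_zero q hTc hT0 E' g hg hN hm).1
  have hmin : ∀ m, coeff m (expansion q B (PowerSeries.X * g)) ≠ 0 → rx + ry + d ≤ m 0 + m 1 :=
    fun m hm => (excExp_le_of_coeff_expansion_ne_zero q hB hB0 E _ hXg hNB hm).2
  have hC' := X_pow_mul_expansion_stepZero q hT g hg
  rw [sFlag_eq_min q T E' g (by omega), sFlag_eq_min q B E _ (by omega), hd]
  simp only [coeffIdealOrder_eq_inf_mk]
  unfold residual
  rw [heB, heT]
  exact companion_min_add_factorial_of_step_xy q 0 1 zero_ne_one_fin fin_two_cases _ _ hC' rx rx' ry d hdq hrx hn hn' hmin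
    (fun i => PowerSeries.mk fun v => coeff (Finsupp.single 0 v + Finsupp.single 1 i)
      ((monomial (Finsupp.single 0 rx + Finsupp.single 1 ry) (1 : k)) ^ d))
    (fun i => PowerSeries.mk fun v => coeff (Finsupp.single 0 v + Finsupp.single 1 i)
      ((monomial (Finsupp.single 0 rx' + Finsupp.single 1 ry) (1 : k)) ^ d))
    (fun i => PowerSeries.mk fun v => coeff (Finsupp.single 0 v + Finsupp.single 1 i)
      ((divMonomial (Finsupp.single 0 rx + Finsupp.single 1 ry) (expansion q B (PowerSeries.X * g))) ^ (q - d)))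
    (fun i => PowerSeries.mk fun v => coeff (Finsupp.single 0 v + Finsupp.single 1 i)
      ((divMonomial (Finsupp.single 0 rx' + Finsupp.single 1 ry) (expansion q T g)) ^ (q - d)))
    (fun j v => by rw [PowerSeries.coeff_mk]) (fun j v => by rw [PowerSeries.coeff_mk])
    (fun j v => by rw [PowerSeries.coeff_mk]) (fun j v => by rw [PowerSeries.coeff_mk])

/-- **In the companion branch `0 < d_res < q`, `s_𝓕 < ⊤` for every `n = 0` flag** of a clean non-zero position: row `0` of `M^d =
x^{d·r_x}` is non-zero when `y ∉ E`; row `0` of `G^{q−d}` is non-zero when `y ∈ E` (then `h = 0`, row `0` of `G` is non-zero since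
`r_y = ord_y`, and `k[[x]]` is a domain).  No non-terminality is needed. [HP24 Prop. 3 p. 792 (finiteness of the maximum)] -/
theorem sFlag_ne_top_of_lt (q : ℕ) {C : MvPowerSeries (Fin 2) k} (hC : cleanSeries q C = C) (hC0 : C ≠ 0) {E : Finset (Fin 2)}
    (hd0 : 0 < dRes C E) (hdq : dRes C E < q) (g : PowerSeries k) (hN : IsN0 E g) : sFlag q C E g ≠ ⊤ := by
  classical
  set d := dRes C E with hdd
  have hcpos : 0 < (q - d) * d := Nat.mul_pos (by omega) hd0
  have hw : ((((q - d) * d).factorial / ((q - d) * d) : ℕ) : ℕ∞) ≠ ⊤ := ENat.coe_ne_top _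
  rw [sFlag_eq_min q C E g (by omega)]
  by_cases hy : (1 : Fin 2) ∈ E
  · -- `y ∈ E`, `g = 0`: row `0` of `G^{q-d}`
    have hg0 : g = 0 := hN.resolve_left (fun h => h hy)
    subst hg0
    refine ne_top_of_le_ne_top ?_ (min_le_right _ _)
    refine ne_top_of_le_ne_top (WithTop.mul_ne_top hw (rowOrder_zero_pow_ne_top ?_ _)) (coeffIdealOrder_le_row_zero hcpos _)
    obtain ⟨m, hm, hm1⟩ := exists_coeff_ne_zero_ordAlong (1 : Fin 2) hC0
    have hle := excExp_le_of_coeff_ne_zero C E hm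
    have hr1 : excExp C E 1 = m 1 := by rw [excExp_apply, if_pos hy, hm1, ENat.toNat_coe]
    have hne : coeff (Finsupp.single (0 : Fin 2) (m 0 - excExp C E 0) + Finsupp.single 1 0) (residual q C E 0) ≠ 0 := by
      rw [coeff_residual, expansion_zero, hC, Nat.add_zero, hr1, show excExp C E 0 + (m 0 - excExp C E 0) = m 0 by
        have := hle 0; omega, ← c_ssa m]
      exact hm
    exact ne_top_of_le_ne_top (ENat.coe_ne_top _) (rowOrder_le_of_coeff_ne_zero hne)
  · -- `y ∉ E`: row `0` of `M^d = x^{d r_x}`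
    refine ne_top_of_le_ne_top ?_ (min_le_left _ _)
    refine ne_top_of_le_ne_top (WithTop.mul_ne_top hw ?_) (coeffIdealOrder_le_row_zero hcpos _)
    obtain ⟨r, hr⟩ : ∃ r, excExp C E = Finsupp.single 0 r := ⟨_, excExp_eq_single_of_not_mem hy⟩
    have hM : monomial (excExp C E) (1 : k) ^ d = monomial (Finsupp.single 0 (d * r)) 1 := by
      rw [hr, monomial_pow, one_pow, Finsupp.smul_single, smul_eq_mul]
    rw [hM]
    refine ne_top_of_le_ne_top (ENat.coe_ne_top (d * r)) (rowOrder_le_of_coeff_ne_zero ?_)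
    rw [Finsupp.single_zero, add_zero, coeff_monomial_same]
    exact one_ne_zero

/-- **[HP24, Prop. 4 (i)], child flag `V(z₁, y + g(x))` (`n = 0`, first orientation), COMPANION BRANCH `0 < d_res(B) < q`**,
DropZeroStatement shape: for the axis successor `X 0 ^ q · T = B(x, xy)` of a clean position and an `n = 0` flag `g` of
`(T, succE 0 E)`, the parent flag `f = X·g` satisfies `flagTriple q T E′ g < flagTriple q B E f`: either `d′_res < d_res`, or
`s_𝓖 + ((q − d)d)! = s_𝓕` with `s_𝓖 < ⊤`.  No non-terminality hypothesis at all. [HP24 Prop. 4 (i) p. 795 l. 6–20] -/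
theorem exists_flag_gt_of_isN0_stepZero_lt (q : ℕ) {B T : MvPowerSeries (Fin 2) k} (hB : cleanSeries q B = B)
    (hB0 : B ≠ 0) (hqo : ((q : ℕ) : ℕ∞) ≤ B.order)
    (hT : (X 0 : MvPowerSeries (Fin 2) k) ^ q * T = subst (PlaneGerm.dirChart (0 : k)) B) {E E' : Finset (Fin 2)}
    (h0 : (0 : Fin 2) ∈ E') (h1 : (1 : Fin 2) ∈ E' ↔ (1 : Fin 2) ∈ E) (hd0 : 0 < dRes B E) (hdq : dRes B E < q)
    (g : PowerSeries k) (hg : PowerSeries.constantCoeff g = 0) (hN : IsN0 E' g) :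
    ∃ f : PowerSeries k, PowerSeries.constantCoeff f = 0 ∧ (IsN0 E f ∨ IsTangent E f) ∧
      flagTriple q T E' g < flagTriple q B E f := by
  classical
  have hTc := cleanSeries_of_stepZero q hB hT
  have hT0 := ne_zero_stepZero q hB0 hT
  have hXg : PowerSeries.constantCoeff (PowerSeries.X * g) = 0 := by rw [map_mul, PowerSeries.constantCoeff_X, zero_mul]
  have hNf : IsN0 E (PowerSeries.X * g) := by
    rcases hN with h1' | hg0
    · exact Or.inl (fun hm => h1' (h1.mpr hm))
    · exact Or.inr (by rw [hg0, mul_zero])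
  refine ⟨PowerSeries.X * g, hXg, Or.inl hNf, ?_⟩
  rw [flagTriple_of_isN0 q T hN, flagTriple_of_isN0 q B hNf, Prod.Lex.toLex_lt_toLex]
  rcases (dRes_stepZero_le q hB0 hqo hT h0 h1).lt_or_eq with hlt | heq
  · left; exact hlt
  · right
    refine ⟨heq, ?_⟩
    rw [Prod.Lex.toLex_lt_toLex]
    right
    refine ⟨rfl, ?_⟩
    show sFlag q T E' g < sFlag q B E (PowerSeries.X * g)
    have hadd := sFlag_stepZero_add_cfactorial q hB hB0 hqo hT h0 h1 hd0 hdq heq g hg hN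
    have hfin := sFlag_ne_top_of_lt q hTc hT0 (E := E') (by rw [heq]; exact hd0) (by rw [heq]; exact hdq) g hN
    obtain ⟨n, hn⟩ := ENat.ne_top_iff_exists.mp hfin
    rw [← hadd, ← hn]
    calc ((n : ℕ) : ℕ∞) < ((n + ((q - dRes B E) * dRes B E).factorial : ℕ) : ℕ∞) := by
          rw [Nat.cast_lt]; have := Nat.factorial_pos ((q - dRes B E) * dRes B E); omega
      _ = (n : ℕ∞) + ((((q - dRes B E) * dRes B E).factorial : ℕ) : ℕ∞) := by rw [Nat.cast_add]

/-- rows of `G^n` along the zero shift lie in degree `≥ n·d_res` (`ord G = d_res`). -/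
private theorem c_mul_dRes_le_of_coeff_residual_pow (q : ℕ) {C : MvPowerSeries (Fin 2) k} (hC : cleanSeries q C = C) (hC0 : C ≠ 0)
    (E : Finset (Fin 2)) (n : ℕ) {m : Fin 2 →₀ ℕ} (hm : coeff m ((residual q C E 0) ^ n) ≠ 0) : n * dRes C E ≤ m 0 + m 1 := by
  have h1 : ((dRes C E : ℕ) : ℕ∞) ≤ (residual q C E 0).order := by
    refine MvPowerSeries.nat_le_order fun a ha => ?_
    by_contra hne
    rw [c_ssa a, coeff_residual, expansion_zero, hC] at hne
    have h2 := c_exc_add_dRes_le hC0 E hne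
    rw [c_l, c_r] at h2
    rw [c_deg] at ha
    have : (a 0 + a 1 : ℕ) < dRes C E := by exact_mod_cast ha
    omega
  have h3 := le_trans (le_trans (nsmul_le_nsmul_right h1 n) (MvPowerSeries.le_order_pow (f := residual q C E 0) n))
    (MvPowerSeries.order_le hm)
  rw [c_deg, nsmul_eq_mul, ← Nat.cast_mul, Nat.cast_le] at h3
  exact h3

/-- in the companion branch, the `G`-part of `s` along the zero shift is at least `c!`, `c = (q − d)d`. -/
theorem cfactorial_le_coeffIdealOrder_residual_pow (q : ℕ) {C : MvPowerSeries (Fin 2) k} (hC : cleanSeries q C = C) (hC0 : C ≠ 0)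
    (E : Finset (Fin 2)) :
    (((((q - dRes C E) * dRes C E).factorial : ℕ)) : ℕ∞) ≤
      coeffIdealOrder ((q - dRes C E) * dRes C E) (0 : Fin 2) 1 ((residual q C E 0) ^ (q - dRes C E)) := by
  rw [coeffIdealOrder_eq_inf_mk]
  refine factorial_le_inf_rows _ fun i a hne => ?_
  rw [PowerSeries.coeff_mk] at hne
  have := c_mul_dRes_le_of_coeff_residual_pow q hC hC0 E (q - dRes C E) hne
  rw [c_l, c_r] at this
  omega

end PurePowerFlag

end Summit.ResolutionOfSingularities.ResolutionOfSingularities.Theorems
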